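import Summits.Ventures.GridStability.Lyapunov.NE39LossySplitLinesLPDualTests
import Summits.Ventures.GridStability.Lyapunov.NE39LossySplitLinesLPCert
import Literature.MathematicalPhysics.PowerSystems.LuriePostnikovSlabPositivityDual
import HarnessLib

/-!
# «NE39-LOSSY-SPLITU-CEILING» — BOTH slab classes on the UNORDERED-LINES split presentation of the lossy 39-bus 10-machine
# Kron model are EMPTY from `2·arctan(13/800)` (≈ 1.862°) on: a RANK-19 GRAM-FACTORED LP dual witness, and the bracket

**OBSTRUCTION row beside «NE39-LOSSY-SPLITU».**  For `S = NE39.splitLurieLinesSystem` (MODEL M = `NE39.preLossless.toModelRel (1/10) 0`: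
New-England 39-bus data Kron-reduced to the ten machine internal nodes WITH transfer conductances, ASSUMED uniform damping ratio
`1/10`; Pai's split presentation (3.43), one sine and one cosine channel per ordered pair, `Models/NE39SplitLurieLines.lean`) and
the window `γ₀ = 2·arctan(13/800)` (≈ 1.862°):

* `D : LPSlabDualWitness NE39.splitLurieLinesSystem a0 b0` — lit-6's LP dual witness (`Z ⪰ 0`, (D1) EXACT, (D2), (D3′), (D4)) whose
  `219 × 219` matrix `Z = [[Z₁₁, Z₂₁ᵀ], [Z₂₁, Z₂₂]]` is NEVER decided: it is `[G1; H]·[G1; H]ᵀ` for the rational factor of data file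
  A (rank 19), positive semidefinite by `Matrix.posSemidef_self_mul_conjTranspose` (`psd`); the blocks the functionals read
  (`Z₁₁`, `Z₂₁`, `diag Z₂₂`) are the kernel-decided tables (`Z11Q_gram`, `Z21Q_gram`; `Z₂₂ := H·Hᵀ` by definition).  WHY THIS IS
  GENERAL: on a split presentation `C·B = 0`, so no dual functional reads `Z₂₂` off its diagonal, and for any feasible `Z` the
  choice `Z₂₂ := Z₂₁Z₁₁⁻¹Z₂₁ᵀ` keeps `Z ⪰ 0` (Schur) and only IMPROVES (D2) — the optimal witness has rank `≤ n_states`;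
* `no_lpSplitCertificate_at` / `no_lpSplitCertificate` / `lpSplitClass_empty_NE39` — **no** `Λ : LPSlabCertificate S` satisfies the
  sector hypothesis of lit-6's LP ROA theorem for the window `γ₀`, nor for any window `≥ γ₀`; `no_lpSplitCertificate_perChannel`;
* `no_splitSlabCertificate_NE39` / `splitSlabClass_empty_NE39` — hence **no** certificate of the class OF RECORD (`SlabCertificate S`)
  either (`SlabCertificate.false_of_lpDualWitness_of_exists_window`);
* `splitClassCeiling_bracket_NE39` — with «NE39-LOSSY-SPLITU» (`NE39LossySplitLinesLPCert.lpSplitClass_nonempty_NE39`: an exact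
  positivity certificate at `2·arctan(1/100)` ≈ 1.146°) the split positivity-class optimum on this object lies in
  `[2·arctan(1/100), 2·arctan(13/800))` = [1.146°, 1.862°); the class of record is EMPTY from 1.862° too;
* `γ1_100_lt_γ₀`, `γ₀_le`, `cos_sin_γ₀` — the windows in closed form.

Producer (not trusted; every acceptance inequality is re-decided over `ℚ` in the kernel, files `…LPDualKernel` /
`…LPDualTests`): lit-6 g10 kit j295583 (`probes/splitgen/splitu_generic.py` JOB_SYSTEM=NE39 JOB_MODE=dualgram JOB_ACT=pairs, class `lp`;
output `splitu_NE39_dualgram_lam1o10_pairs.json` sha16 `5d0b2446791d9484`, results[u0 = 13/800]): max-margin LP dual SDP in floats (CLARABEL,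
`N = 19 + 180`, margin `μ* ≈ 5.21e-10`), then the GRAM FACTORISATION `G1 = chol(Z₁₁)` (19 × 19 lower), `H = Z₂₁·G1⁻ᵀ` (180 × 19),
dyadic rounding `2^-24`, and `Z := [G1; H]·[G1; H]ᵀ` EXACTLY — rank 19, positive semidefinite BY CONSTRUCTION (no 219 × 219
decision anywhere); since `C·B = 0` no dual functional reads `Z₂₂` off its diagonal, and the diagonal `|H_k|²` is the smallest
admissible one.  Exact re-check (`gen_ne39_dual.py`): `W + Wᵀ` min pivot `2.54e-07`, min (D2) `3.23e-10`, min (D3′) margin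
`8.06e-08`, `tr Z₁₁ = 1`.
THREE COLUMNS.  CERTIFIED: «no certificate of either typed split class (`LPSlabCertificate S` ⊇ `SlabCertificate S` via `toLP`,
+ `hsec`) certifies a slab half-width `≥ 2·arctan(13/800)` (≈ 1.862°) on model-4's lossy 39-bus model; the positivity class
is NON-EMPTY at 1.146°».  VALIDATED (floats, lit-6 kit j292614 / j293727 / j295583): positivity class primal margin `ν* > 0` at
`u ≤ 3/200` (1.72°), class of record `ν* > 0` at `u ≤ 1/100` and `< 0` at `3/200`, both `< 0` at `1/50`; dual margins as in data
file A.  MODELLED: as «NE39-LOSSY-SPLITU» / model-4's record.  The sentence is about CERTIFICATE CLASSES, not about the region of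
attraction of M or of any grid.
[cite: BoydVandenberghe2004, §5.9.4 (5.97)–(5.98), Example 5.14; Khalil2002, §7.1 Example 7.5, §7.1.2 Theorem 7.3; Pai1981, §3.6.3 (3.43)–(3.45), §4.6 p. 117; HornJohnson2013, Thm 7.2.7]
-/

noncomputable section

open Real Matrix
open Literature.Computation.Certificates
open Literature.MathematicalPhysics.PowerSystems
open Literature.MathematicalPhysics.PowerSystems.LyapunovFunctionFamily
open Summit.Ventures.GridStability.Models
open Summit.Ventures.GridStability.Lyapunov.NE39LossySplitLines (e1 AQ CQ BLQ A_eq C_eq B_eq C_mul_B)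

namespace Summit.Ventures.GridStability.Lyapunov.NE39LossySplitLinesLPDual

/-! ### Cast plumbing (the parent files' copies are private) -/

/-- `(M + N) ↦ ℝ` (cast plumbing). -/ private theorem map_add' {m n : Type*} (M N : Matrix m n ℚ) :
    (M + N).map (Rat.cast : ℚ → ℝ) = M.map (Rat.cast : ℚ → ℝ) + N.map (Rat.cast : ℚ → ℝ) := by
  ext i k; simp
/-- `(M − N) ↦ ℝ` (cast plumbing). -/ private theorem map_sub' {m n : Type*} (M N : Matrix m n ℚ) :
    (M - N).map (Rat.cast : ℚ → ℝ) = M.map (Rat.cast : ℚ → ℝ) - N.map (Rat.cast : ℚ → ℝ) := by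
  ext i k; simp
/-- `(q • M) ↦ ℝ` (cast plumbing). -/ private theorem map_smul' {m n : Type*} (q : ℚ) (M : Matrix m n ℚ) :
    (q • M).map (Rat.cast : ℚ → ℝ) = ((q : ℚ) : ℝ) • M.map (Rat.cast : ℚ → ℝ) := by
  ext i k; simp
/-- `(M N) ↦ ℝ` (cast plumbing). -/ private theorem map_mul' {l m n : Type*} [Fintype m] (M : Matrix l m ℚ) (N : Matrix m n ℚ) :
    (M * N).map (Rat.cast : ℚ → ℝ) = M.map (Rat.cast : ℚ → ℝ) * N.map (Rat.cast : ℚ → ℝ) := by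
  ext i k; simp [Matrix.mul_apply]
/-- `Mᵀ ↦ ℝ` (cast plumbing). -/ private theorem map_transpose' {m n : Type*} (M : Matrix m n ℚ) :
    Mᵀ.map (Rat.cast : ℚ → ℝ) = (M.map (Rat.cast : ℚ → ℝ))ᵀ := by
  ext i k; simp

/-! ### The witness data over `ℝ` -/

/-- `Z₁₁ ↦ ℝ`. -/
def Z₁₁ : Matrix (Fin 10 ⊕ Fin 9) (Fin 10 ⊕ Fin 9) ℝ := Z11Q.map (Rat.cast : ℚ → ℝ)
/-- `Z₂₁ ↦ ℝ`. -/
def Z₂₁ : Matrix ((Fin 10 × Fin 10) ⊕ (Fin 10 × Fin 10)) (Fin 10 ⊕ Fin 9) ℝ := Z21Q.map (Rat.cast : ℚ → ℝ)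
/-- `Z₂₂ = H·Hᵀ ↦ ℝ`. -/
def Z₂₂ : Matrix ((Fin 10 × Fin 10) ⊕ (Fin 10 × Fin 10)) ((Fin 10 × Fin 10) ⊕ (Fin 10 × Fin 10)) ℝ := Z22Q.map (Rat.cast : ℚ → ℝ)
/-- The factor's state block over `ℝ`. -/
def G1r : Matrix (Fin 10 ⊕ Fin 9) (Fin 19) ℝ := G1T.map (Rat.cast : ℚ → ℝ)
/-- The factor's channel block over `ℝ`. -/
def Hr : Matrix ((Fin 10 × Fin 10) ⊕ (Fin 10 × Fin 10)) (Fin 19) ℝ := HT.map (Rat.cast : ℚ → ℝ)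
/-- The witness's lower slopes over `ℝ`. -/
def a0 (k : (Fin 10 × Fin 10) ⊕ (Fin 10 × Fin 10)) : ℝ := (a0K k : ℝ)
/-- The witness's upper slopes over `ℝ`. -/
def b0 (k : (Fin 10 × Fin 10) ⊕ (Fin 10 × Fin 10)) : ℝ := (b0K k : ℝ)
/-- The window `γ₀ = 2·arctan(13/800)` (≈ 1.862°). -/
def γ₀ : ℝ := 2 * Real.arctan ((u0Q : ℚ) : ℝ)

/-- `γ₀` is the literal window `2·arctan(13/800)` of the row's name. -/
theorem γ₀_eq : γ₀ = 2 * Real.arctan (13 / 800 : ℝ) := by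
  unfold γ₀; norm_num [u0Q]

/-- `cos γ₀ = cg0Q` (cast form, feeds `hwin`). -/
private theorem cos_γ₀_cast : Real.cos γ₀ = ((cg0Q : ℚ) : ℝ) := by
  unfold γ₀ cg0Q
  rw [Lyapunov.StructurePreserving.cos_two_mul_arctan]
  push_cast
  ring

/-- `sin γ₀ = sg0Q` (cast form, feeds `hwin`). -/
private theorem sin_γ₀_cast : Real.sin γ₀ = ((sg0Q : ℚ) : ℝ) := by
  unfold γ₀ sg0Q
  rw [Lyapunov.StructurePreserving.sin_two_mul_arctan]
  push_cast
  ring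

/-- **`cos(2·arctan(13/800)) = 639831/640169`**, **`sin = 20800/640169`** (closed forms). -/
theorem cos_sin_γ₀ : Real.cos (2 * Real.arctan (13 / 800 : ℝ)) = 639831 / 640169 ∧ Real.sin (2 * Real.arctan (13 / 800 : ℝ)) = 20800 / 640169 := by
  rw [← γ₀_eq, cos_γ₀_cast, sin_γ₀_cast]; constructor <;> norm_num [cg0Q, sg0Q, u0Q]

/-- `0 ≤ γ₀ < π/2`. -/
private theorem γ₀_range : 0 ≤ γ₀ ∧ γ₀ < π / 2 := by
  have hu : (0 : ℝ) ≤ ((u0Q : ℚ) : ℝ) := by exact_mod_cast u0Q_pos_lt.1.le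
  have hu1 : ((u0Q : ℚ) : ℝ) < 1 := by exact_mod_cast u0Q_pos_lt.2
  exact ⟨Lyapunov.StructurePreserving.two_mul_arctan_nonneg hu,
    Lyapunov.StructurePreserving.two_mul_arctan_lt_pi_div_two hu1⟩

/-- `γ₀ ≤ 13 / 400` rad (`arctan u ≤ u`). -/
theorem γ₀_le : γ₀ ≤ 13 / 400 := by
  unfold γ₀
  have h : Real.arctan ((u0Q : ℚ) : ℝ) ≤ ((u0Q : ℚ) : ℝ) :=
    Lyapunov.StructurePreserving.arctan_le_self (by exact_mod_cast u0Q_pos_lt.1.le)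
  have : ((u0Q : ℚ) : ℝ) = 13 / 800 := by norm_num [u0Q]
  linarith

/-! ### `Z ⪰ 0` BY THE GRAM STRUCTURE, and (D1) over `ℝ` -/

/-- The receptacle's block matrix IS `[G1; H]·[G1; H]ᵀ` (plumbing). -/
private theorem fromBlocks_eq_gram :
    Matrix.fromBlocks Z₁₁ Z₂₁ᵀ Z₂₁ Z₂₂ = Matrix.fromRows G1r Hr * (Matrix.fromRows G1r Hr)ᴴ := by
  rw [Matrix.conjTranspose_eq_transpose_of_trivial, Matrix.transpose_fromRows, Matrix.fromRows_mul_fromCols,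
    Z₁₁, Z₂₁, Z₂₂, Z11Q_gram, Z21Q_gram, Z22Q, G1r, Hr, map_mul', map_mul', map_mul', map_transpose', map_transpose',
    Matrix.transpose_mul, Matrix.transpose_transpose]

/-- **`Z ⪰ 0`** — for free: a Gram matrix (feeds `D`). [cite: HornJohnson2013, Thm 7.2.7] -/
private theorem psd : (Matrix.fromBlocks Z₁₁ Z₂₁ᵀ Z₂₁ Z₂₂).PosSemidef := by
  rw [fromBlocks_eq_gram]
  exact Matrix.posSemidef_self_mul_conjTranspose _

/-- **The adjoint image is rational**: `W + Wᵀ = HQ ↦ ℝ` (plumbing). -/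
private theorem adj_eq : dualAdjP NE39.splitLurieLinesSystem Z₁₁ Z₂₁ + (dualAdjP NE39.splitLurieLinesSystem Z₁₁ Z₂₁)ᵀ
    = HQ.map (Rat.cast : ℚ → ℝ) := by
  have hX : dualAdjP NE39.splitLurieLinesSystem Z₁₁ Z₂₁ = XQ.map (Rat.cast : ℚ → ℝ) := by
    rw [dualAdjP, A_eq, B_eq, Z₁₁, Z₂₁, XQ, map_sub', map_add', map_mul', map_mul', map_transpose',
      map_smul', map_mul', Rat.cast_ofNat]
  rw [hX, HQ, map_add', map_transpose']

/-- **(D1)** `W + Wᵀ ⪰ 0` (feeds `D`). -/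
private theorem adjP_psd :
    (dualAdjP NE39.splitLurieLinesSystem Z₁₁ Z₂₁ + (dualAdjP NE39.splitLurieLinesSystem Z₁₁ Z₂₁)ᵀ).PosSemidef := by
  rw [adj_eq, HQ_eq]
  exact (HD_ldl.posSemidef (R := ℝ)).submatrix e1

/-! ### (D2), (D3′), (D4) and the null channels over `ℝ` -/

/-- The five dual functionals are the casts of `UQ`, `VQ`, `WQ`, `SQ`, `QQ` (the positivity functional
`q_k = (C·W·Cᵀ)_kk` loses its `B`-part because `C·B = 0`, and `Z₁₁Aᵀ + AZ₁₁` is the table `Xlit`). -/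
theorem functionals_eq (k : (Fin 10 × Fin 10) ⊕ (Fin 10 × Fin 10)) :
    (NE39.splitLurieLinesSystem.C * Z₁₁ * NE39.splitLurieLinesSystem.Cᵀ) k k = ((UQ k : ℚ) : ℝ) ∧
    (Z₂₁ * NE39.splitLurieLinesSystem.Cᵀ) k k = ((VQ k : ℚ) : ℝ) ∧
    Z₂₂ k k = ((WQ k : ℚ) : ℝ) ∧
    dualPopovCoeff NE39.splitLurieLinesSystem Z₂₁ Z₂₂ k = ((SQ k : ℚ) : ℝ) ∧
    dualLowerCoeff NE39.splitLurieLinesSystem Z₁₁ Z₂₁ k = ((QQ k : ℚ) : ℝ) := by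
  have hCB := C_mul_B
  refine ⟨?_, ?_, ?_, ?_, ?_⟩
  · rw [C_eq, Z₁₁, ← map_transpose', ← map_mul', ← map_mul', Matrix.map_apply, UQ]
  · rw [C_eq, Z₂₁, ← map_transpose', ← map_mul', Matrix.map_apply, VQ]
  · rw [Z₂₂, Matrix.map_apply, WQ]
  · rw [dualPopovCoeff, Matrix.mul_assoc, ← Matrix.mul_assoc NE39.splitLurieLinesSystem.C, hCB,
      Matrix.zero_mul, Matrix.zero_apply, sub_zero, C_eq, A_eq, Z₂₁, ← map_mul', ← map_transpose',
      ← map_mul', Matrix.map_apply, SQ]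
  · have hsplit : NE39.splitLurieLinesSystem.C * dualAdjP NE39.splitLurieLinesSystem Z₁₁ Z₂₁ * NE39.splitLurieLinesSystem.Cᵀ
        = NE39.splitLurieLinesSystem.C * (Z₁₁ * NE39.splitLurieLinesSystem.Aᵀ + NE39.splitLurieLinesSystem.A * Z₁₁) * NE39.splitLurieLinesSystem.Cᵀ := by
      rw [dualAdjP, Matrix.mul_sub, Matrix.sub_mul, Matrix.mul_smul, Matrix.smul_mul,
        ← Matrix.mul_assoc NE39.splitLurieLinesSystem.C NE39.splitLurieLinesSystem.B, hCB, Matrix.zero_mul, Matrix.zero_mul, smul_zero, sub_zero]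
    rw [dualLowerCoeff, hsplit, C_eq, A_eq, Z₁₁, ← map_transpose', ← map_mul', ← map_mul', ← map_add',
      XQ0_eq, ← map_mul', ← map_transpose', ← map_mul', Matrix.map_apply, QQ]

/-- **(D2)** at the witness slopes (feeds `D`). -/
private theorem sectorCoeff_nonneg (k : (Fin 10 × Fin 10) ⊕ (Fin 10 × Fin 10)) :
    0 ≤ dualSectorCoeff NE39.splitLurieLinesSystem Z₁₁ Z₂₁ Z₂₂ a0 b0 k := by
  obtain ⟨hU, hV, hW, -, -⟩ := functionals_eq k
  rw [dualSectorCoeff, hU, hV, hW, a0, b0]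
  exact_mod_cast (lpDual_tests k).1

/-- **(D3′)** on every channel: `a0_k · q_k ≤ 2 s_k` (feeds `D`). -/
private theorem lowerPopovCoeff_le (k : (Fin 10 × Fin 10) ⊕ (Fin 10 × Fin 10)) :
    a0 k * dualLowerCoeff NE39.splitLurieLinesSystem Z₁₁ Z₂₁ k ≤ 2 * dualPopovCoeff NE39.splitLurieLinesSystem Z₂₁ Z₂₂ k := by
  obtain ⟨-, -, -, hS, hQ⟩ := functionals_eq k
  rw [hS, hQ, a0]
  exact_mod_cast (lpDual_tests k).2.1

/-- **(D4a)** `a0 < b0` (feeds `D`). -/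
private theorem slope_lt (k : (Fin 10 × Fin 10) ⊕ (Fin 10 × Fin 10)) : a0 k < b0 k := by
  unfold a0 b0; exact_mod_cast (lpDual_tests k).2.2.1

/-- **(D4b)** `tr Z₁₁ > 0` (feeds `D`). -/
private theorem trace_pos : 0 < Matrix.trace Z₁₁ := by
  have h : Matrix.trace Z₁₁ = ((Matrix.trace Z11Q : ℚ) : ℝ) := by
    simp [Z₁₁, Matrix.trace, Rat.cast_sum]
  rw [h]; exact_mod_cast trace_test

/-- **THE LP DUAL WITNESS** against the Lur'e–Postnikov POSITIVITY certificate class on `S = NE39.splitLurieLinesSystem` at the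
window-extreme slopes `(a0, b0)` of the window `γ₀ = 2·arctan(13/800)` — rank 19, Gram-factored.
[cite: BoydVandenberghe2004, §5.9.4 (5.97)–(5.98), Example 5.14; Khalil2002, §7.1 Example 7.5] -/
def D : LPSlabDualWitness NE39.splitLurieLinesSystem a0 b0 where
  Z₁₁ := Z₁₁
  Z₂₁ := Z₂₁
  Z₂₂ := Z₂₂
  psd := psd
  adjP_psd := adjP_psd
  sectorCoeff_nonneg := sectorCoeff_nonneg
  lowerPopovCoeff_le := lowerPopovCoeff_le
  slope_lt := slope_lt
  trace_pos := trace_pos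

/-- The diagonal channels (both families) are NULL for the LP witness (five vanishing functionals). -/
private theorem isNull_diag (k : (Fin 10 × Fin 10) ⊕ (Fin 10 × Fin 10)) (hk : (pairOf k).1 = (pairOf k).2) : D.IsNull k := by
  obtain ⟨hU, hV, hW, hS, hQ⟩ := functionals_eq k
  obtain ⟨h1, h2, h3, h4, h5⟩ := (lpDual_tests k).2.2.2 hk
  refine ⟨⟨?_, ?_, ?_, ?_⟩, ?_⟩
  · show (NE39.splitLurieLinesSystem.C * Z₁₁ * NE39.splitLurieLinesSystem.Cᵀ) k k = 0; rw [hU]; exact_mod_cast h1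
  · show (Z₂₁ * NE39.splitLurieLinesSystem.Cᵀ) k k = 0; rw [hV]; exact_mod_cast h2
  · show Z₂₂ k k = 0; rw [hW]; exact_mod_cast h3
  · show dualPopovCoeff NE39.splitLurieLinesSystem Z₂₁ Z₂₂ k = 0; rw [hS]; exact_mod_cast h4
  · show dualLowerCoeff NE39.splitLurieLinesSystem Z₁₁ Z₂₁ k = 0; rw [hQ]; exact_mod_cast h5

/-! ### The window points of the 180 channels `p ≠ q` (exact cosines; `ξ = 0` on the wide sine channels) -/

/-- The two window end points `δ ± γ` and their cosines from `(cos δ, sin δ) = (cδ, sδ)`, `(cos γ, sin γ) = (c, s)`. -/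
private theorem window_points {δ γ cδ sδ c s : ℝ} (hc : Real.cos δ = cδ) (hs : Real.sin δ = sδ)
    (hcg : Real.cos γ = c) (hsg : Real.sin γ = s) (hγ : 0 ≤ γ) :
    (∃ ξ, |ξ - δ| ≤ γ ∧ Real.cos ξ = cδ * c - sδ * s) ∧ (∃ ξ, |ξ - δ| ≤ γ ∧ Real.cos ξ = cδ * c + sδ * s) :=
  ⟨⟨δ + γ, by simp [abs_of_nonneg hγ], by rw [Real.cos_add, hc, hs, hcg, hsg]⟩,
    ⟨δ - γ, by simp [abs_of_nonneg hγ], by rw [Real.cos_sub, hc, hs, hcg, hsg]⟩⟩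

/-- The centre `ξ = 0` lies in the window `|ξ − δ| ≤ γ` as soon as `cos γ ≤ cos δ` (`|δ| < π/2`, `0 ≤ γ < π/2`), and
`cos 0 = 1`. -/
private theorem center_point {δ γ cδ c : ℝ} (hδ : |δ| < π / 2) (hγ0 : 0 ≤ γ) (_hγ : γ < π / 2)
    (hc : Real.cos δ = cδ) (hcg : Real.cos γ = c) (hle : c ≤ cδ) :
    ∃ ξ, |ξ - δ| ≤ γ ∧ Real.cos ξ = 1 := by
  refine ⟨0, ?_, Real.cos_zero⟩
  rw [zero_sub, abs_neg]
  by_contra hlt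
  push Not at hlt
  have h1 : Real.cos |δ| < Real.cos γ :=
    Real.cos_lt_cos_of_nonneg_of_le_pi hγ0 (by linarith [abs_nonneg δ, Real.pi_pos]) hlt
  rw [Real.cos_abs, hc, hcg] at h1
  linarith

/-- **`hwin`**: every channel is NULL or has window points `ξa`, `ξb` in `|ξ − δ*_k| ≤ γ₀` with `cos ξa ≤ a0_k`,
`b0_k ≤ cos ξb`. -/
private theorem hwin : ∀ k, D.IsNull k ∨
    ((∃ ξ, |ξ - NE39.splitLurieLinesSystem.δs k| ≤ γ₀ ∧ Real.cos ξ ≤ a0 k) ∧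
      ∃ ξ, |ξ - NE39.splitLurieLinesSystem.δs k| ≤ γ₀ ∧ b0 k ≤ Real.cos ξ) := by
  rintro (⟨p, q⟩ | ⟨p, q⟩)
  · by_cases hpq : p = q
    · exact Or.inl (isNull_diag _ hpq)
    right
    have hδs : NE39.splitLurieLinesSystem.δs (Sum.inl (p, q)) = NE39.preLossless.angleOf p - NE39.preLossless.angleOf q := rfl
    obtain ⟨⟨ξ₁, hξ₁, hc₁⟩, ξ₂, hξ₂, hc₂⟩ := window_points (NE39.cos_angleOf_sub p q)
      (NE39.sin_angleOf_sub p q) cos_γ₀_cast sin_γ₀_cast γ₀_range.1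
    obtain ⟨hlo, hhi⟩ := window_tests_sin p q hpq
    rw [hδs]
    refine ⟨?_, ?_⟩
    · rcases hlo with h | h
      · exact ⟨ξ₁, hξ₁, by rw [hc₁, a0]; exact_mod_cast h⟩
      · exact ⟨ξ₂, hξ₂, by rw [hc₂, a0]; exact_mod_cast h⟩
    · rcases hhi with (h | h) | ⟨hw, hb⟩
      · exact ⟨ξ₁, hξ₁, by rw [hc₁, b0]; exact_mod_cast h⟩
      · exact ⟨ξ₂, hξ₂, by rw [hc₂, b0]; exact_mod_cast h⟩
      · obtain ⟨ξ₀, hξ₀, hc₀⟩ := center_point (NE39.abs_angle_sub_lt p q) γ₀_range.1 γ₀_range.2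
          (NE39.cos_angleOf_sub p q) cos_γ₀_cast (by exact_mod_cast hw)
        exact ⟨ξ₀, hξ₀, by rw [hc₀, b0]; exact_mod_cast hb⟩
  · by_cases hpq : p = q
    · exact Or.inl (isNull_diag _ hpq)
    right
    have hδs : NE39.splitLurieLinesSystem.δs (Sum.inr (p, q)) = NE39.preLossless.angleOf p - NE39.preLossless.angleOf q + π / 2 := rfl
    have hc : Real.cos (NE39.preLossless.angleOf p - NE39.preLossless.angleOf q + π / 2) = -((NE39.preLossless.sd p q : ℚ) : ℝ) := by
      rw [Real.cos_add_pi_div_two, NE39.sin_angleOf_sub]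
    have hs : Real.sin (NE39.preLossless.angleOf p - NE39.preLossless.angleOf q + π / 2) = ((NE39.preLossless.cd p q : ℚ) : ℝ) := by
      rw [Real.sin_add_pi_div_two, NE39.cos_angleOf_sub]
    obtain ⟨⟨ξ₁, hξ₁, hc₁⟩, ξ₂, hξ₂, hc₂⟩ := window_points hc hs cos_γ₀_cast sin_γ₀_cast γ₀_range.1
    obtain ⟨hlo, hhi⟩ := window_tests_cos p q hpq
    rw [hδs]
    refine ⟨?_, ?_⟩
    · rcases hlo with h | h
      · exact ⟨ξ₁, hξ₁, by rw [hc₁, a0]; exact_mod_cast h⟩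
      · exact ⟨ξ₂, hξ₂, by rw [hc₂, a0]; exact_mod_cast h⟩
    · rcases hhi with h | h
      · exact ⟨ξ₁, hξ₁, by rw [hc₁, b0]; exact_mod_cast h⟩
      · exact ⟨ξ₂, hξ₂, by rw [hc₂, b0]; exact_mod_cast h⟩

/-! ### THE THEOREMS -/

/-- **No Lur'e–Postnikov POSITIVITY certificate on the split presentation of the lossy 39-bus model at `γ₀`.**
[cite: BoydVandenberghe2004, §5.9.4 (5.97)–(5.98), Example 5.14; Khalil2002, §7.1 Example 7.5] -/
theorem no_lpSplitCertificate_at (Λ : LPSlabCertificate NE39.splitLurieLinesSystem)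
    (hsec : ∀ k ξ, |ξ - NE39.splitLurieLinesSystem.δs k| ≤ γ₀ → Λ.a k ≤ Real.cos ξ ∧ Real.cos ξ ≤ Λ.b k) :
    False :=
  Λ.false_of_lpDualWitness_of_exists_window D (γ := fun _ => γ₀) hsec hwin

/-- **No positivity certificate at any window `γ ≥ γ₀`.** -/
theorem no_lpSplitCertificate (Λ : LPSlabCertificate NE39.splitLurieLinesSystem) {γ : ℝ} (hγ : γ₀ ≤ γ)
    (hsec : ∀ k ξ, |ξ - NE39.splitLurieLinesSystem.δs k| ≤ γ → Λ.a k ≤ Real.cos ξ ∧ Real.cos ξ ≤ Λ.b k) :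
    False :=
  no_lpSplitCertificate_at Λ fun k ξ hξ => hsec k ξ (hξ.trans hγ)

/-- **The split positivity class on the 39-bus object is empty from `γ₀` on** (set form). -/
theorem lpSplitClass_empty_NE39 (γ : ℝ) (hγ : γ₀ ≤ γ) :
    ¬ ∃ Λ : LPSlabCertificate NE39.splitLurieLinesSystem,
      ∀ k ξ, |ξ - NE39.splitLurieLinesSystem.δs k| ≤ γ → Λ.a k ≤ Real.cos ξ ∧ Real.cos ξ ≤ Λ.b k :=
  fun ⟨Λ, hsec⟩ => no_lpSplitCertificate Λ hγ hsec

/-- **Per-channel windows**: the refutation needs the window only on the 180 channels `p ≠ q` and only `γ_k ≥ γ₀` there. -/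
theorem no_lpSplitCertificate_perChannel (Λ : LPSlabCertificate NE39.splitLurieLinesSystem) (γ : (Fin 10 × Fin 10) ⊕ (Fin 10 × Fin 10) → ℝ)
    (hγ : ∀ k, (pairOf k).1 ≠ (pairOf k).2 → γ₀ ≤ γ k)
    (hsec : ∀ k ξ, |ξ - NE39.splitLurieLinesSystem.δs k| ≤ γ k → Λ.a k ≤ Real.cos ξ ∧ Real.cos ξ ≤ Λ.b k) :
    False := by
  refine Λ.false_of_lpDualWitness_of_exists_window D (γ := γ) hsec fun k => ?_
  by_cases hk : (pairOf k).1 = (pairOf k).2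
  · exact Or.inl (isNull_diag k hk)
  · rcases hwin k with h | ⟨⟨ξa, hξa, hca⟩, ξb, hξb, hcb⟩
    · exact Or.inl h
    · exact Or.inr ⟨⟨ξa, hξa.trans (hγ k hk), hca⟩, ξb, hξb.trans (hγ k hk), hcb⟩

/-- **No certificate of the class OF RECORD either** (`SlabCertificate S`), at any window `≥ γ₀`.
[cite: BoydVandenberghe2004, §5.9.4; Pai1981, §2.16 Theorem [18]] -/
theorem no_splitSlabCertificate_NE39 (Λ : SlabCertificate NE39.splitLurieLinesSystem) {γ : ℝ} (hγ : γ₀ ≤ γ)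
    (hsec : ∀ k ξ, |ξ - NE39.splitLurieLinesSystem.δs k| ≤ γ → Λ.a k ≤ Real.cos ξ ∧ Real.cos ξ ≤ Λ.b k) :
    False :=
  Λ.false_of_lpDualWitness_of_exists_window D (γ := fun _ => γ₀)
    (fun k ξ hξ => hsec k ξ (hξ.trans hγ)) hwin

/-- **The split class of record on the 39-bus object is empty from `γ₀` on** (set form). -/
theorem splitSlabClass_empty_NE39 (γ : ℝ) (hγ : γ₀ ≤ γ) :
    ¬ ∃ Λ : SlabCertificate NE39.splitLurieLinesSystem,
      ∀ k ξ, |ξ - NE39.splitLurieLinesSystem.δs k| ≤ γ → Λ.a k ≤ Real.cos ξ ∧ Real.cos ξ ≤ Λ.b k :=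
  fun ⟨Λ, hsec⟩ => no_splitSlabCertificate_NE39 Λ hγ hsec

/-- **THE BRACKET on the 39-bus object**: the split positivity class is NON-EMPTY at `2·arctan(1/100)` (≈ 1.146°,
«NE39-LOSSY-SPLITU» `NE39LossySplitLinesLPCert.lpCert`) and EMPTY (with the class of record) at every window
`≥ γ₀ = 2·arctan(13/800)` (≈ 1.862°). -/
theorem splitClassCeiling_bracket_NE39 :
    (∃ Λ : LPSlabCertificate NE39.splitLurieLinesSystem,
      ∀ k ξ, |ξ - NE39.splitLurieLinesSystem.δs k| ≤ 2 * Real.arctan (1 / 100 : ℝ) → Λ.a k ≤ Real.cos ξ ∧ Real.cos ξ ≤ Λ.b k) ∧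
    (∀ γ' : ℝ, γ₀ ≤ γ' → ¬ ∃ Λ : LPSlabCertificate NE39.splitLurieLinesSystem,
      ∀ k ξ, |ξ - NE39.splitLurieLinesSystem.δs k| ≤ γ' → Λ.a k ≤ Real.cos ξ ∧ Real.cos ξ ≤ Λ.b k) ∧
    ∀ γ' : ℝ, γ₀ ≤ γ' → ¬ ∃ Λ : SlabCertificate NE39.splitLurieLinesSystem,
      ∀ k ξ, |ξ - NE39.splitLurieLinesSystem.δs k| ≤ γ' → Λ.a k ≤ Real.cos ξ ∧ Real.cos ξ ≤ Λ.b k :=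
  ⟨NE39LossySplitLinesLPCert.lpSplitClass_nonempty_NE39, lpSplitClass_empty_NE39, splitSlabClass_empty_NE39⟩

/-- «NE39-LOSSY-SPLITU»'s window lies strictly below this file's: `2·arctan(1/100) < γ₀ = 2·arctan(13/800)`. -/
theorem γ1_100_lt_γ₀ : 2 * Real.arctan (1 / 100 : ℝ) < γ₀ := by
  unfold γ₀
  have h : (1 / 100 : ℝ) < ((u0Q : ℚ) : ℝ) := by norm_num [u0Q]
  have := Real.arctan_strictMono h
  linarith

end Summit.Ventures.GridStability.Lyapunov.NE39LossySplitLinesLPDual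

end
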